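import Literature.Analysis.FluidPDE.PassiveScalarShearFibreDamping
import Literature.Analysis.FluidPDE.SawtoothCascade
import HarnessLib

/-!
# The sawtooth pulse cascade: bare-rate damping of the streamwise fibres across each half-slot (proved)

Instantiation, for the rounded-sawtooth pulse cascade of `SawtoothCascade` (cell `ad-ideate`, seat ad-p2,
route `SawtoothPulseCascade`), of the general shear-flow fibre-damping theorem
`Torus.IsClassicalScalarTransportOn.scalarL2Sq_add_highModeEnergy_le` (`PassiveScalarShearFibreDamping`):
on the H half-slot `[tStart j, tStart j + tHalf j]` the cascade field is the single horizontal shear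
`(rateH j t · U j (x₂), 0)` (`CascadeParams.field_eq_of_mem_H`), parallel to `e₀` and independent of `x₀`,
so a classical cascade scalar loses across the slot at least the fraction `1 - e^{-8π²κK² tHalf j}` of the
energy it carried in the horizontal fibres `|k₀| ≥ K` (`CascadeParams.shearSlotDamping_H` — the registered stub
S2 `stub_shearSlotDamping` of the line `K1LocalisedCascade.Spectral`, with its necessary side condition
`0 ≤ K` and `highModeEnergy K = Torus.highModeEnergy 0 K`); symmetrically on the V half-slot for the vertical
fibres `|k₁| ≥ K` (`CascadeParams.shearSlotDamping_V`).  Theorems only; no facts, no axioms.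
[cite: BedrossianCotiZelati2017, §1 (streamwise decoupling of shear flows, k-by-k heat-rate decay)]
[cite: ElgindiLissMattingly2025, §1 (u_α = H_α, V_α on the half periods)] [problem: turb]
-/


open MeasureTheory Set Filter

noncomputable section

namespace Literature.Analysis.FluidPDE.SawtoothCascade

open Literature.Analysis.FunctionSpaces

namespace CascadeParams

variable (P : CascadeParams)

/-- `(a, 0) = a • e₀` in `ℝ²`. [folklore] -/
private theorem toLp_vec_zero_right (a : ℝ) :
    (WithLp.toLp 2 ![a, 0] : EuclideanSpace ℝ (Fin 2)) = a • EuclideanSpace.single 0 (1 : ℝ) := by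
  ext i; fin_cases i <;> simp [EuclideanSpace.single]

/-- `(0, b) = b • e₁` in `ℝ²`. [folklore] -/
private theorem toLp_vec_zero_left (b : ℝ) :
    (WithLp.toLp 2 ![0, b] : EuclideanSpace ℝ (Fin 2)) = b • EuclideanSpace.single 1 (1 : ℝ) := by
  ext i; fin_cases i <;> simp [EuclideanSpace.single]

/-- Axis translations along `e₀` do not move the second coordinate. [folklore] -/
private theorem repr_add_single_zero_one (x : UnitAddTorus (Fin 2)) (s : UnitAddCircle) :
    Torus.repr (x + Pi.single (0 : Fin 2) s) 1 = Torus.repr x 1 := by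
  rw [Torus.repr_apply, Torus.repr_apply, Pi.add_apply, Pi.single_eq_of_ne (by decide : (1 : Fin 2) ≠ 0),
    add_zero]

/-- Axis translations along `e₁` do not move the first coordinate. [folklore] -/
private theorem repr_add_single_one_zero (x : UnitAddTorus (Fin 2)) (s : UnitAddCircle) :
    Torus.repr (x + Pi.single (1 : Fin 2) s) 0 = Torus.repr x 0 := by
  rw [Torus.repr_apply, Torus.repr_apply, Pi.add_apply, Pi.single_eq_of_ne (by decide : (0 : Fin 2) ≠ 1),
    add_zero]

/-- On an H half-slot the cascade field is parallel to `e₀`. [cite: ElgindiLissMattingly2025, §1 (u_α = H_α on its half period)] -/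
theorem field_eq_smul_single_of_mem_H {j : ℕ} {t : ℝ} (ht : t ∈ Icc (tStart j) (tStart j + tHalf j))
    (x : UnitAddTorus (Fin 2)) :
    P.field t x = (P.field t x 0) • EuclideanSpace.single 0 (1 : ℝ) := by
  rw [P.field_eq_of_mem_H ht x, toLp_vec_zero_right]
  simp

/-- On an H half-slot the cascade field does not depend on `x₀`. [cite: ElgindiLissMattingly2025, §1 (u_α = H_α on its half period)] -/
theorem field_add_single_zero_of_mem_H {j : ℕ} {t : ℝ} (ht : t ∈ Icc (tStart j) (tStart j + tHalf j))
    (s : UnitAddCircle) (x : UnitAddTorus (Fin 2)) :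
    P.field t (x + Pi.single (0 : Fin 2) s) = P.field t x := by
  rw [P.field_eq_of_mem_H ht, P.field_eq_of_mem_H ht, repr_add_single_zero_one]

/-- On a V half-slot the cascade field is parallel to `e₁`. [cite: ElgindiLissMattingly2025, §1 (u_α = V_α on its half period)] -/
theorem field_eq_smul_single_of_mem_V {j : ℕ} {t : ℝ} (ht : t ∈ Icc (tStart j + tHalf j) (tStart (j + 1)))
    (x : UnitAddTorus (Fin 2)) :
    P.field t x = (P.field t x 1) • EuclideanSpace.single 1 (1 : ℝ) := by
  rw [P.field_eq_of_mem_V ht x, toLp_vec_zero_left]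
  simp

/-- On a V half-slot the cascade field does not depend on `x₁`. [cite: ElgindiLissMattingly2025, §1 (u_α = V_α on its half period)] -/
theorem field_add_single_one_of_mem_V {j : ℕ} {t : ℝ} (ht : t ∈ Icc (tStart j + tHalf j) (tStart (j + 1)))
    (s : UnitAddCircle) (x : UnitAddTorus (Fin 2)) :
    P.field t (x + Pi.single (1 : Fin 2) s) = P.field t x := by
  rw [P.field_eq_of_mem_V ht, P.field_eq_of_mem_V ht, repr_add_single_one_zero]

/-- The H half-slot of phase `j` lies in `[0, 1)`. [cite: ElgindiLissMattingly2025, Rmk. 1.4 (the pulse clock)] -/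
theorem Icc_H_subset_Ico (j : ℕ) : Icc (tStart j) (tStart j + tHalf j) ⊆ Ico (0 : ℝ) 1 :=
  fun _ ht => ⟨(tStart_nonneg j).trans ht.1, ht.2.trans_lt (tStart_add_tHalf_lt_one j)⟩

/-- The V half-slot of phase `j` lies in `[0, 1)`. [cite: ElgindiLissMattingly2025, Rmk. 1.4 (the pulse clock)] -/
theorem Icc_V_subset_Ico (j : ℕ) : Icc (tStart j + tHalf j) (tStart (j + 1)) ⊆ Ico (0 : ℝ) 1 :=
  fun _ ht => ⟨((tStart_nonneg j).trans (le_add_of_nonneg_right (tHalf_pos j).le)).trans ht.1,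
    ht.2.trans_lt (tStart_lt_one (j + 1))⟩

/-- **Stub S2 of the line `K1LocalisedCascade.Spectral` (H half-slot), proved**: across
`[tStart j, tStart j + tHalf j]` a classical cascade scalar (`κ ≥ 0`) satisfies
`‖w(t₁)‖² + (1 - e^{-8π²κK² tHalf j}) · E_{|k₀| ≥ K}(w(t₀)) ≤ ‖w(t₀)‖²` in `ℝ≥0∞`, for every `K ≥ 0`.
[cite: BedrossianCotiZelati2017, §1 (k-by-k heat-rate decay for shear flows)] -/
theorem shearSlotDamping_H {κ : ℝ} (hκ : 0 ≤ κ) (j : ℕ) {K : ℝ} (hK : 0 ≤ K)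
    {w : ℝ → UnitAddTorus (Fin 2) → ℝ} (hw : Torus.IsClassicalScalarTransportOn (Ico 0 1) κ P.field w) :
    ENNReal.ofReal (Torus.scalarL2Sq (w (tStart j + tHalf j))) +
        ENNReal.ofReal (1 - Real.exp (-(8 * Real.pi ^ 2 * κ * K ^ 2 * tHalf j))) *
          Torus.highModeEnergy 0 K (w (tStart j)) ≤
      ENNReal.ofReal (Torus.scalarL2Sq (w (tStart j))) := by
  have h := hw.scalarL2Sq_add_highModeEnergy_le hκ (le_add_of_nonneg_right (tHalf_pos j).le)
    (Icc_H_subset_Ico j) 0 (fun t ht x => P.field_eq_smul_single_of_mem_H ht x)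
    (fun t ht s x => P.field_add_single_zero_of_mem_H ht s x) hK
  rwa [add_sub_cancel_left] at h

/-- **The V half-slot twin**: across `[tStart j + tHalf j, tStart (j+1)]` the vertical fibres `|k₁| ≥ K`
are damped at the bare rate: `‖w(t₁)‖² + (1 - e^{-8π²κK² tHalf j}) · E_{|k₁| ≥ K}(w(t₀)) ≤ ‖w(t₀)‖²`.
[cite: BedrossianCotiZelati2017, §1 (k-by-k heat-rate decay for shear flows)] -/
theorem shearSlotDamping_V {κ : ℝ} (hκ : 0 ≤ κ) (j : ℕ) {K : ℝ} (hK : 0 ≤ K)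
    {w : ℝ → UnitAddTorus (Fin 2) → ℝ} (hw : Torus.IsClassicalScalarTransportOn (Ico 0 1) κ P.field w) :
    ENNReal.ofReal (Torus.scalarL2Sq (w (tStart (j + 1)))) +
        ENNReal.ofReal (1 - Real.exp (-(8 * Real.pi ^ 2 * κ * K ^ 2 * tHalf j))) *
          Torus.highModeEnergy 1 K (w (tStart j + tHalf j)) ≤
      ENNReal.ofReal (Torus.scalarL2Sq (w (tStart j + tHalf j))) := by
  have hle : tStart j + tHalf j ≤ tStart (j + 1) := by
    rw [tStart_succ]; linarith [tHalf_pos j]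
  have h := hw.scalarL2Sq_add_highModeEnergy_le hκ hle
    (Icc_V_subset_Ico j) 1 (fun t ht x => P.field_eq_smul_single_of_mem_V ht x)
    (fun t ht s x => P.field_add_single_one_of_mem_V ht s x) hK
  have e : tStart (j + 1) - (tStart j + tHalf j) = tHalf j := by rw [tStart_succ]; ring
  rwa [e] at h

end CascadeParams

end Literature.Analysis.FluidPDE.SawtoothCascade

end
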